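import Summits.Ventures.CertifiedManyBodySolver.Downfold.EmeryContourNesting
import Summits.Ventures.CertifiedManyBodySolver.Downfold.EmeryFermiScaleLever
import HarnessLib

/-!
# THE COMPOSITE LEVER STEPS OF THE SCALE COORDINATE: from a contour-nesting certificate (sharp Fermi-energy modulus) and a path inequality,
# `T(member) ≤ T(anchor)` (UPPER step) or `T(anchor) ≤ T(member)` (LOWER step) for the fixed-doping one-band `t_node` (INFL-3to1-B §B.88 (g)–(i))

Venture CertifiedManyBodySolver, cell `pub/hubbard-downfold` (stage S1; INFLATION-RULES-3to1-B §B.88), seat hubbard-downfold-mod-4 (technique B = band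
level, g36); namespace `Summit.Ventures.CertifiedManyBodySolver.Downfold.Emery`. Everything PROVED (0 sorry, no definition). WHAT THIS IS NOT: a statement
about any material; `U = 0` one-body kinematics of the σ model; no number lives here.

OBJECT. `T(θ) = t_node(θ; ε_F(θ; ν))` with `t(θ, e) = scaleNodeN θ e / scaleNodeD θ e` (`EmeryFermiScaleNode`): the velocity-matched one-band nearest-neighbour
hopping at the node of the σ Fermi surface, at FIXED FILLING. Along a parameter move two channels compete: the fixed-energy change of `t` and the motion of
the Fermi energy times `∂t/∂e < 0` (`scaleNode_div_strictAnti`, the scale lever of §B.74 restated for the closed form). The step theorems below take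
(i) a CONTOUR-NESTING hypothesis on an energy window (discharged cell-wise by the kernel checker `EmeryScaleLeverCheck` through `EmeryContourNesting`),
which bounds the member's Fermi energy from the pessimistic side by `ε_F(anchor) ∓ ℓ·s`, and (ii) a PATH hypothesis `t(member, E ∓ ℓs) ≶ t(anchor, E)`
on the anchor's window, and conclude the composite comparison. The `t_pp′` coordinate may be pinned DIFFERENTLY for the rows whose Fermi energies are
compared (`cN`) and the rows at which `t` is evaluated (`cP`) — the one-step virtual treatment of `t_pp′` (§B.88 (j)): the comparison is then between the
mixed quantities `t((Δ, a, b, cP); ε_F(Δ, a, b, cN))`.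

* §1 `scaleNode_div_strictAnti` (energy antitonicity of `N/D` in the regime `t_pp′e < t_pd²`, `t_ppΔ < 4t_pd²`), `scaleNode_div_pos`.
* §2 **`scaleNode_upper_step`**: `t(M_P; ε_F(M_N)) ≤ t(A_P; ε_F(A_N))` and `ε_F(A_N) − ℓs ≤ ε_F(M_N)`.
* §3 **`scaleNode_lower_step`**: `t(A_P; ε_F(A_N)) ≤ t(M_P; ε_F(M_N))` and `ε_F(M_N) ≤ ε_F(A_N) + us`.

Sources: three-band model [HybertsenSchluterChristensen1989, Eq. (1)]; energy-linearised one-band image [AndersenEtAl1995, §6]; arithmetic [folklore].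
-/

noncomputable section

namespace Summit.Ventures.CertifiedManyBodySolver.Downfold.Emery

open Real Set

/-! ## §1 Energy antitonicity and positivity of `scaleNodeN/scaleNodeD` -/

/-- **`N/D` IS STRICTLY DECREASING IN THE ENERGY** (`Δ > 0`, `0 ≤ t_pp′ ≤ t_pp`, `t_pd ≠ 0`, `0 < ε₁ < ε₂`, `t_pp′ε₂ < t_pd²`, `t_ppΔ < 4t_pd²`). [folklore] -/
theorem scaleNode_div_strictAnti {Δ tpd tpp c ε₁ ε₂ : ℝ} (hΔ : 0 < Δ) (hc : 0 ≤ c) (hct : c ≤ tpp) (htpd : tpd ≠ 0) (h1 : 0 < ε₁) (h12 : ε₁ < ε₂)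
    (hm : c * ε₂ < tpd ^ 2) (hq : tpp * Δ < 4 * tpd ^ 2) :
    scaleNodeN Δ tpd tpp c ε₂ / scaleNodeD Δ tpd tpp c ε₂ < scaleNodeN Δ tpd tpp c ε₁ / scaleNodeD Δ tpd tpp c ε₁ := by
  have h2 : 0 < ε₂ := h1.trans h12
  rw [div_lt_div_iff₀ (scaleNodeD_pos (by linarith) h2.le hc hct htpd) (scaleNodeD_pos (by linarith) h1.le hc hct htpd), ← sub_pos]
  obtain ⟨h, rfl⟩ : ∃ h, tpp = c + h := ⟨tpp - c, by ring⟩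
  obtain ⟨d, rfl⟩ : ∃ d, ε₂ = ε₁ + d := ⟨ε₂ - ε₁, by ring⟩
  have hh : 0 ≤ h := by linarith
  have hd : 0 < d := by linarith
  rw [scaleNode_cross_eq Δ tpd c h ε₁ d]
  have ha : 0 < tpd ^ 2 := by positivity
  exact mul_pos hd (scaleCert_pos hΔ.le h1 hd ha hc hh (by linarith) (by linarith))

/-- `N/D` is non-increasing in the energy on `(0, ∞)` in the regime (weak form). [folklore] -/
theorem scaleNode_div_antitone {Δ tpd tpp c ε₁ ε₂ : ℝ} (hΔ : 0 < Δ) (hc : 0 ≤ c) (hct : c ≤ tpp) (htpd : tpd ≠ 0) (h1 : 0 < ε₁) (h12 : ε₁ ≤ ε₂)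
    (hm : c * ε₂ < tpd ^ 2) (hq : tpp * Δ < 4 * tpd ^ 2) :
    scaleNodeN Δ tpd tpp c ε₂ / scaleNodeD Δ tpd tpp c ε₂ ≤ scaleNodeN Δ tpd tpp c ε₁ / scaleNodeD Δ tpd tpp c ε₁ := by
  rcases h12.lt_or_eq with h | h
  · exact (scaleNode_div_strictAnti hΔ hc hct htpd h1 h hm hq).le
  · rw [h]

/-- `N/D > 0` in the regime (`Δ + e > 0`, `e ≥ 0`, `0 ≤ t_pp′ ≤ t_pp`, `t_pd ≠ 0`, `t_pp′e < t_pd²`). [folklore] -/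
theorem scaleNode_div_pos {Δ tpd tpp c e : ℝ} (hE : 0 < Δ + e) (he : 0 ≤ e) (hc : 0 ≤ c) (hct : c ≤ tpp) (htpd : tpd ≠ 0) (hm : c * e < tpd ^ 2) :
    0 < scaleNodeN Δ tpd tpp c e / scaleNodeD Δ tpd tpp c e := by
  rw [← scaleT_node_eq hE he hc hct htpd]
  exact scaleT_node_pos hE he hc hct htpd hm

/-! ## §2 The UPPER step -/

section Upper

variable {Δ₀ a₀ b₀ Δ₁ a₁ b₁ cN cP ν lo hi lc hiM ℓ s : ℝ}

/-- **THE UPPER STEP.** Anchor `A = (Δ₀, a₀, b₀)`, member `M = (Δ₁, a₁, b₁)`; Fermi energies of the `cN`-rows `E_A = ε_F(A, cN)`, `E_M = ε_F(M, cN)`; `t`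
evaluated at the `cP`-rows. Hypotheses: `E_A ∈ [lo, hi]`, `E_M ∈ [lc, hiM]` (crude), `0 ≤ ℓs < lo`; NESTING on `[lc, hiM]`
(`occupied(M, E) ⊆ occupied(A, E + ℓs)` via the contour criterion); PATH on `[lo, hi]` (`t(M_P, E − ℓs) ≤ t(A_P, E)`); regime at `M_P` up to `hiM`.
Conclusion: **`t(M_P, E_M) ≤ t(A_P, E_A)`** and **`E_A − ℓs ≤ E_M`**. [folklore] -/
theorem scaleNode_upper_step (hΔ₀ : 0 < Δ₀) (hb₀ : 0 ≤ b₀) (hΔ₁ : 0 < Δ₁) (ha₁ : a₁ ≠ 0) (hb₁ : 0 ≤ b₁) (hcN : 0 ≤ cN)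
    (hcP : 0 ≤ cP) (hcPb : cP ≤ b₁) (hν0 : 0 < ν) (hν1 : ν < 1)
    (hW : fermiEnergyOf Δ₀ a₀ b₀ cN ν ∈ Icc lo hi) (hWM : fermiEnergyOf Δ₁ a₁ b₁ cN ν ∈ Icc lc hiM) (hℓs : 0 ≤ ℓ * s)
    (hlo : ℓ * s < lo)
    (hnest : ∀ E ∈ Icc lc hiM, ∀ x y : ℝ, x ∈ Icc (0 : ℝ) 1 → y ∈ Icc (0 : ℝ) 1 →
      0 ≤ charCubic Δ₁ a₁ b₁ cN x y E → 0 ≤ charCubic Δ₀ a₀ b₀ cN x y (E + ℓ * s))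
    (hpath : ∀ E ∈ Icc lo hi, scaleNodeN Δ₁ a₁ b₁ cP (E - ℓ * s) / scaleNodeD Δ₁ a₁ b₁ cP (E - ℓ * s) ≤
      scaleNodeN Δ₀ a₀ b₀ cP E / scaleNodeD Δ₀ a₀ b₀ cP E)
    (hregm : cP * hiM < a₁ ^ 2) (hregq : b₁ * Δ₁ < 4 * a₁ ^ 2) :
    scaleNodeN Δ₁ a₁ b₁ cP (fermiEnergyOf Δ₁ a₁ b₁ cN ν) / scaleNodeD Δ₁ a₁ b₁ cP (fermiEnergyOf Δ₁ a₁ b₁ cN ν) ≤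
        scaleNodeN Δ₀ a₀ b₀ cP (fermiEnergyOf Δ₀ a₀ b₀ cN ν) / scaleNodeD Δ₀ a₀ b₀ cP (fermiEnergyOf Δ₀ a₀ b₀ cN ν) ∧
      fermiEnergyOf Δ₀ a₀ b₀ cN ν - ℓ * s ≤ fermiEnergyOf Δ₁ a₁ b₁ cN ν := by
  set EA := fermiEnergyOf Δ₀ a₀ b₀ cN ν with hEA
  set EM := fermiEnergyOf Δ₁ a₁ b₁ cN ν with hEM
  -- (1) the nesting certificate at E := E_M bounds E_A ≤ E_M + ℓs
  have hEM0 : 0 < EM := fermiEnergyOf_pos hΔ₁ ha₁ hcN hb₁ hν0 hν1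
  have hbound : EA ≤ EM + ℓ * s := by
    refine fermiEnergyOf_le_of_transfer hΔ₁ ha₁ hcN hb₁ hΔ₀.le hcN hb₀ hν0 hν1 (by linarith) ?_
    intro x y hx hy hP
    exact hnest EM hWM x y hx hy hP
  refine ⟨?_, by linarith⟩
  -- (2) path at E := E_A, then energy antitonicity at the member between E_A − ℓs and E_M
  have hp := hpath EA hW
  have h1 : 0 < EA - ℓ * s := by have := hW.1; linarith
  have h12 : EA - ℓ * s ≤ EM := by linarith
  have hm : cP * EM < a₁ ^ 2 := lt_of_le_of_lt (mul_le_mul_of_nonneg_left hWM.2 hcP) hregm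
  have hanti := scaleNode_div_antitone hΔ₁ hcP hcPb ha₁ h1 h12 hm hregq
  exact hanti.trans hp

end Upper

/-! ## §3 The LOWER step -/

section Lower

variable {Δ₀ a₀ b₀ Δ₁ a₁ b₁ cN cP ν lo hi u s : ℝ}

/-- **THE LOWER STEP.** Anchor `A = (Δ₀, a₀, b₀)`, member `M = (Δ₁, a₁, b₁)`; `E_A = ε_F(A, cN) ∈ [lo, hi]`, `0 ≤ us`, `0 < lo`; NESTING on `[lo, hi]`
(`occupied(A, E) ⊆ occupied(M, E + us)`); PATH on `[lo, hi]` (`t(A_P, E) ≤ t(M_P, E + us)`); regime at `M_P` up to `hi + us`.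
Conclusion: **`t(A_P, E_A) ≤ t(M_P, E_M)`** and **`E_M ≤ E_A + us`**. [folklore] -/
theorem scaleNode_lower_step (hΔ₀ : 0 < Δ₀) (ha₀ : a₀ ≠ 0) (hb₀ : 0 ≤ b₀) (hΔ₁ : 0 < Δ₁) (ha₁ : a₁ ≠ 0) (hb₁ : 0 ≤ b₁) (hcN : 0 ≤ cN)
    (hcP : 0 ≤ cP) (hcPb : cP ≤ b₁) (hν0 : 0 < ν) (hν1 : ν < 1)
    (hW : fermiEnergyOf Δ₀ a₀ b₀ cN ν ∈ Icc lo hi) (hlo : 0 < lo) (hus : 0 ≤ u * s)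
    (hnest : ∀ E ∈ Icc lo hi, ∀ x y : ℝ, x ∈ Icc (0 : ℝ) 1 → y ∈ Icc (0 : ℝ) 1 →
      0 ≤ charCubic Δ₀ a₀ b₀ cN x y E → 0 ≤ charCubic Δ₁ a₁ b₁ cN x y (E + u * s))
    (hpath : ∀ E ∈ Icc lo hi, scaleNodeN Δ₀ a₀ b₀ cP E / scaleNodeD Δ₀ a₀ b₀ cP E ≤
      scaleNodeN Δ₁ a₁ b₁ cP (E + u * s) / scaleNodeD Δ₁ a₁ b₁ cP (E + u * s))
    (hregm : cP * (hi + u * s) < a₁ ^ 2) (hregq : b₁ * Δ₁ < 4 * a₁ ^ 2) :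
    scaleNodeN Δ₀ a₀ b₀ cP (fermiEnergyOf Δ₀ a₀ b₀ cN ν) / scaleNodeD Δ₀ a₀ b₀ cP (fermiEnergyOf Δ₀ a₀ b₀ cN ν) ≤
        scaleNodeN Δ₁ a₁ b₁ cP (fermiEnergyOf Δ₁ a₁ b₁ cN ν) / scaleNodeD Δ₁ a₁ b₁ cP (fermiEnergyOf Δ₁ a₁ b₁ cN ν) ∧
      fermiEnergyOf Δ₁ a₁ b₁ cN ν ≤ fermiEnergyOf Δ₀ a₀ b₀ cN ν + u * s := by
  set EA := fermiEnergyOf Δ₀ a₀ b₀ cN ν with hEA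
  set EM := fermiEnergyOf Δ₁ a₁ b₁ cN ν with hEM
  have hEM0 : 0 < EM := fermiEnergyOf_pos hΔ₁ ha₁ hcN hb₁ hν0 hν1
  -- (1) nesting at E := E_A bounds E_M ≤ E_A + us
  have hbound : EM ≤ EA + u * s := by
    refine fermiEnergyOf_le_of_transfer hΔ₀ ha₀ hcN hb₀ hΔ₁.le hcN hb₁ hν0 hν1 (by have := hW.1; linarith) ?_
    intro x y hx hy hP
    exact hnest EA hW x y hx hy hP
  refine ⟨?_, hbound⟩
  -- (2) path at E := E_A, then antitonicity at the member between E_M and E_A + us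
  have hp := hpath EA hW
  have hm : cP * (EA + u * s) < a₁ ^ 2 := by
    have : EA + u * s ≤ hi + u * s := by have := hW.2; linarith
    exact lt_of_le_of_lt (mul_le_mul_of_nonneg_left this hcP) hregm
  have hanti := scaleNode_div_antitone hΔ₁ hcP hcPb ha₁ hEM0 hbound hm hregq
  exact hp.trans hanti

end Lower

end Summit.Ventures.CertifiedManyBodySolver.Downfold.Emery
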